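import Summits.AtomisticToContinuum.Crystallization.Theorems.FrustratedLawDichotomyStrainedPatchHomLeafTablePenHcpV

/-!
# hcp vector-form leaf checker — ★★★ SOUNDNESS of `leafCheckV` in POINTS FORM

decomp-a2c hand-2 g25 (crux `AperiodicFrustratedLawGap`, stmt-AtomisticToContinuum-27623; (H) hcp P-twin, critic rows 887/891/893).
★★★ `leafCheckV_sound_points`: if the table is semantically certified (`TabSem E tab`, hand-2 g24 — row-version-agnostic), the records are consistent
and pairwise distinct, and `leafCheckV tab labs E k sμ aμ = true`, then for every scaled-frame matrix `V` and scaled shuffle `η` in the leaf box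
(`|V_ac − v_ac/SC| ≤ w_ac/SC`, `|η_c − n_c/SC| ≤ m_c/SC`):
(i) `±aμ/(2·SC) ≤ Σ_{treated records l} W₄₅(√(q_l))`, `q_l = ‖V (e_l + u_l η)‖²`, and (ii) every untreated record has `q_l ≥ 81/4`.
Assembly of `…HomLeafVectorForm.leaf_sound_vector_form` (tangent parabolas, floored centre value) with `functional_lower_bound` (moments)
against the accumulator sums `acc_sumsV`, the real readings (`label_value_facts`, `GG_real`, `gg_real`, `C2_real`, `penV_real`, `pen_bound`).
The per-leaf conversion `(U, ξ)`-box ↦ `(V, η)`-box and the entry verdict are the companion entry module.  0 sorry; standard axioms.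
`--supports stmt-AtomisticToContinuum-27623`.
-/

noncomputable section

namespace Summit.AtomisticToContinuum.Crystallization.Theorems.FrustratedLawDichotomyStrainedPatchHomLeafTableCheckHcpV

open scoped BigOperators
open Set Finset
open Literature.Analysis.ValidatedNumerics.Numerics
open Summit.AtomisticToContinuum.Crystallization.Theorems.FrustratedLawDichotomySchurCut (effPot w₄₅ ω₄)
open Summit.AtomisticToContinuum.Crystallization.Theorems.FrustratedLawDichotomyStrainedPatchHomTermCalculus (hasDerivAt_phi45)
open Summit.AtomisticToContinuum.Crystallization.Theorems.FrustratedLawDichotomyStrainedPatchHomLeafVectorForm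
  (leaf_sound_vector_form functional_lower_bound)
open Summit.AtomisticToContinuum.Crystallization.Theorems.FrustratedLawDichotomyStrainedPatchHomLeafTableCheck
  (Row QT sgnZ SCN addP addN addP_sub_addN abs_sgnZ SCN_eq)
open Summit.AtomisticToContinuum.Crystallization.Theorems.FrustratedLawDichotomyStrainedPatchHomLeafTableCheckHcp
  (NH RowSem TabSem cast_list_sum_intG cast_list_sum_natG)

/-! ## §1. Pieces -/

/-- `GV ≥ penV / SC³` in reals. [formal bookkeeping] -/
theorem penV_le_GV (k : LV) (a : AccV) :
    ((penV k (GGof (A00 a) (B0 a) (B0 a) k.n0 k.n0 (C2 a)) (GGof (A11 a) (B1 a) (B1 a) k.n1 k.n1 (C2 a)) (GGof (A22 a) (B2 a) (B2 a) k.n2 k.n2 (C2 a))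
      (GGof (A01 a) (B0 a) (B1 a) k.n0 k.n1 (C2 a)) (GGof (A02 a) (B0 a) (B2 a) k.n0 k.n2 (C2 a)) (GGof (A12 a) (B1 a) (B2 a) k.n1 k.n2 (C2 a))
      (ggof (B0 a) k.n0 (C2 a)) (ggof (B1 a) k.n1 (C2 a)) (ggof (B2 a) k.n2 (C2 a)) (C2 a) : ℕ) : ℝ) ≤ ((GV k a : ℕ) : ℝ) * SC ^ 3 := by
  set P := penV k (GGof (A00 a) (B0 a) (B0 a) k.n0 k.n0 (C2 a)) (GGof (A11 a) (B1 a) (B1 a) k.n1 k.n1 (C2 a)) (GGof (A22 a) (B2 a) (B2 a) k.n2 k.n2 (C2 a))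
      (GGof (A01 a) (B0 a) (B1 a) k.n0 k.n1 (C2 a)) (GGof (A02 a) (B0 a) (B2 a) k.n0 k.n2 (C2 a)) (GGof (A12 a) (B1 a) (B2 a) k.n1 k.n2 (C2 a))
      (ggof (B0 a) k.n0 (C2 a)) (ggof (B1 a) k.n1 (C2 a)) (ggof (B2 a) k.n2 (C2 a)) (C2 a) with hP
  have hG : GV k a = P / SC3N + 1 := rfl
  have h2 : P < (P / SC3N + 1) * SC3N := by
    rw [Nat.add_mul, Nat.one_mul]; exact Nat.lt_div_mul_add (show 0 < SC3N by norm_num [SC3N])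
  rw [hG, ← SC3N_real]
  exact_mod_cast h2.le

/-- The moment `Γ` is symmetric. [formal bookkeeping] -/
theorem GamR_symm (tab : QT) (k : LV) (labs : List NH) (c c' : Fin 3) : GamR tab k labs c c' = GamR tab k labs c' c := by
  unfold GamR; exact Finset.sum_congr rfl fun l _ => by ring

/-! ## §2. ★★★ Soundness in points form -/

open Classical in
/-- ★★★ **SOUNDNESS OF THE hcp VECTOR-FORM LEAF CHECK, points form.**  See the module docstring. [folklore] -/
theorem leafCheckV_sound_points {tab : QT} {labs : List NH} {E : ℕ} {k : LV} {sμ : Bool} {aμ : ℕ}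
    (htab : TabSem E tab) (hok : ∀ l ∈ labs, l.ok = true) (hnd : labs.Nodup) (h : leafCheckV tab labs E k sμ aμ = true)
    (V : Fin 3 → Fin 3 → ℝ) (η : Fin 3 → ℝ)
    (hV : ∀ a c, |V a c - ((k.vZ a c : ℤ) : ℝ) / SC| ≤ ((k.wN a c : ℕ) : ℝ) / SC) (hη : ∀ c, |η c - ((k.nZ c : ℤ) : ℝ) / SC| ≤ ((k.mN c : ℕ) : ℝ) / SC) :
    ((sgnZ sμ aμ : ℤ) : ℝ) / SC / 2 ≤ ∑ l ∈ trS tab k labs, effPot w₄₅ ω₄ (3 / 400) (Real.sqrt (qre l V η)) ∧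
      ∀ l ∈ labs, treatedV tab k l = false → (81 : ℝ) / 4 ≤ qre l V η := by
  classical
  have hS := SC_pos
  obtain ⟨hokA, hle⟩ := leafCheckV_true h
  obtain ⟨hall, eV, eD, eS, -, eC, eSA, eSR⟩ := acc_sumsV hokA
  set a := foldV tab k accV0 labs with ha
  set S : Finset NH := trS tab k labs with hSS
  set T := labs.filter (fun l => treatedV tab k l) with hT
  have hTsub : T.Sublist labs := List.filter_sublist
  have hTmem : ∀ l ∈ T, l ∈ labs := fun l hl => hTsub.subset hl
  have hTt : ∀ l ∈ T, treatedV tab k l = true := fun l hl => (List.mem_filter.1 hl).2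
  have hTnd : T.Nodup := hnd.sublist hTsub
  have hSdef : S = T.toFinset := by rw [hSS, hT]; rfl
  have hmemS : ∀ l, l ∈ S ↔ l ∈ T := fun l => by rw [hSdef]; exact List.mem_toFinset
  refine ⟨?_, fun l hl ht => far_of_farBV_real (hok l hl) (hall l hl) ht hV hη⟩
  -- per-record facts
  have hokS : ∀ l ∈ S, l.ok = true := fun l hl => hok l (hTmem l ((hmemS l).1 hl))
  have hF : ∀ l ∈ S, RV k l ≤ QV k l ∧ (rowTV tab k l).A ≤ QV k l - RV k l ∧ QV k l + RV k l ≤ (rowTV tab k l).B ∧ (rowTV tab k l).t ≤ QV k l :=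
    fun l hl => by obtain ⟨h1, -, h3, h4, h5⟩ := treatedV_facts (hTt l ((hmemS l).1 hl)); exact ⟨h1, h3, h4, h5⟩
  have RS : ∀ l ∈ S, RowSem E (rowTV tab k l) := fun l hl => htab _ _ (rowTV_eq_of_treated (hTt l ((hmemS l).1 hl)))
  have LVF : ∀ l ∈ S, |qre l V η - qhat k l| ≤ (((RV k l : ℕ) : ℝ) - 1) / SC ∧ ((QV k l : ℕ) : ℝ) / SC ≤ qhat k l ∧
      qhat k l ≤ (((QV k l : ℕ) : ℝ) + 1) / SC := fun l hl => label_value_facts (hokS l hl) hV hη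
  -- δ = Q − t in ℕ is exact
  have hdlt : ∀ l ∈ S, (((dltV tab k l : ℕ) : ℝ)) = ((QV k l : ℕ) : ℝ) - (((rowTV tab k l).t : ℕ) : ℝ) := by
    intro l hl
    obtain ⟨-, -, -, h4⟩ := hF l hl
    unfold dltV; rw [Nat.cast_sub h4]
  -- the functional bound
  have hFun : -(((GV k a : ℕ) : ℝ) / SC ^ 2) ≤ ∑ l ∈ S, ((Dz tab k l : ℤ) : ℝ) / SC * (qre l V η - qhat k l) := by
    have hz : ∀ l ∈ S, ∀ c, zre k l c = ((ZZ k l c : ℤ) : ℝ) / SC := fun l _ c => by rw [ZZ_real]; field_simp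
    have hFLB := functional_lower_bound S (fun l => ((Dz tab k l : ℤ) : ℝ) / SC) (fun l => zre k l) (fun l => (l.u : ℝ))
      (fun l hl => u01_of_ok (hokS l hl)) V (fun a c => ((k.vZ a c : ℤ) : ℝ) / SC) (fun a c => ((k.wN a c : ℕ) : ℝ) / SC) η
      (fun c => ((k.nZ c : ℤ) : ℝ) / SC) (fun c => ((k.mN c : ℕ) : ℝ) / SC) hV hη (GamR tab k labs) (gamR tab k labs) (CR tab k labs)
      (fun c c' => by unfold GamR; exact Finset.sum_congr rfl fun l hl => by rw [hz l hl c, hz l hl c'])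
      (fun c => by unfold gamR; exact Finset.sum_congr rfl fun l hl => by rw [hz l hl c])
      (by unfold CR; rfl)
    have hq : ∀ l ∈ S, ((Dz tab k l : ℤ) : ℝ) / SC * (∑ a', (∑ c, V a' c * (zre k l c + (l.u : ℝ) * (η c - ((k.nZ c : ℤ) : ℝ) / SC))) ^ 2 -
        ∑ a', (∑ c, ((k.vZ a' c : ℤ) : ℝ) / SC * zre k l c) ^ 2) = ((Dz tab k l : ℤ) : ℝ) / SC * (qre l V η - qhat k l) := by
      intro l _; rw [qre_eq k l V η]; rfl
    have hrhs : ∑ l ∈ S, ((Dz tab k l : ℤ) : ℝ) / SC * (∑ a', (∑ c, V a' c * (zre k l c + (l.u : ℝ) * (η c - ((k.nZ c : ℤ) : ℝ) / SC))) ^ 2 -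
        ∑ a', (∑ c, ((k.vZ a' c : ℤ) : ℝ) / SC * zre k l c) ^ 2) = ∑ l ∈ S, ((Dz tab k l : ℤ) : ℝ) / SC * (qre l V η - qhat k l) :=
      Finset.sum_congr rfl hq
    rw [hrhs] at hFLB
    -- PENR ≤ GV / SC²
    have hpen := pen_bound k (sym3 (GGof (A2Z a 0 0) (B2Z a 0) (B2Z a 0) (k.nZ 0) (k.nZ 0) (C2 a)) (GGof (A2Z a 1 1) (B2Z a 1) (B2Z a 1) (k.nZ 1) (k.nZ 1) (C2 a))
        (GGof (A2Z a 2 2) (B2Z a 2) (B2Z a 2) (k.nZ 2) (k.nZ 2) (C2 a)) (GGof (A2Z a 0 1) (B2Z a 0) (B2Z a 1) (k.nZ 0) (k.nZ 1) (C2 a))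
        (GGof (A2Z a 0 2) (B2Z a 0) (B2Z a 2) (k.nZ 0) (k.nZ 2) (C2 a)) (GGof (A2Z a 1 2) (B2Z a 1) (B2Z a 2) (k.nZ 1) (k.nZ 2) (C2 a)))
      ![ggof (B2Z a 0) (k.nZ 0) (C2 a), ggof (B2Z a 1) (k.nZ 1) (C2 a), ggof (B2Z a 2) (k.nZ 2) (C2 a)] (C2 a)
      (GamR tab k labs) (gamR tab k labs) (CR tab k labs) ?hG (GamR_symm tab k labs) ?hg (C2_real hokA hok hnd)
    case hG =>
      intro c c'
      fin_cases c <;> fin_cases c' <;>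
        simp only [sym3, Fin.zero_eta, Fin.isValue, Fin.mk_one, Fin.reduceFinMk, Matrix.cons_val_zero, Matrix.cons_val_one, Matrix.cons_val] <;>
        first
          | exact GG_real hokA hok hnd _ _
          | (rw [GamR_symm]; exact GG_real hokA hok hnd _ _)
    case hg =>
      intro c
      fin_cases c <;>
        simp only [Fin.zero_eta, Fin.isValue, Fin.mk_one, Fin.reduceFinMk, Matrix.cons_val_zero, Matrix.cons_val_one, Matrix.cons_val] <;>
        exact gg_real hokA hok hnd _
    have hKT := penV_real k (GGof (A2Z a 0 0) (B2Z a 0) (B2Z a 0) (k.nZ 0) (k.nZ 0) (C2 a)) (GGof (A2Z a 1 1) (B2Z a 1) (B2Z a 1) (k.nZ 1) (k.nZ 1) (C2 a))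
        (GGof (A2Z a 2 2) (B2Z a 2) (B2Z a 2) (k.nZ 2) (k.nZ 2) (C2 a)) (GGof (A2Z a 0 1) (B2Z a 0) (B2Z a 1) (k.nZ 0) (k.nZ 1) (C2 a))
        (GGof (A2Z a 0 2) (B2Z a 0) (B2Z a 2) (k.nZ 0) (k.nZ 2) (C2 a)) (GGof (A2Z a 1 2) (B2Z a 1) (B2Z a 2) (k.nZ 1) (k.nZ 2) (C2 a))
        (ggof (B2Z a 0) (k.nZ 0) (C2 a)) (ggof (B2Z a 1) (k.nZ 1) (C2 a)) (ggof (B2Z a 2) (k.nZ 2) (C2 a)) (C2 a)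
    have hGV := penV_le_GV k a
    have hsame : penV k (GGof (A2Z a 0 0) (B2Z a 0) (B2Z a 0) (k.nZ 0) (k.nZ 0) (C2 a)) (GGof (A2Z a 1 1) (B2Z a 1) (B2Z a 1) (k.nZ 1) (k.nZ 1) (C2 a))
        (GGof (A2Z a 2 2) (B2Z a 2) (B2Z a 2) (k.nZ 2) (k.nZ 2) (C2 a)) (GGof (A2Z a 0 1) (B2Z a 0) (B2Z a 1) (k.nZ 0) (k.nZ 1) (C2 a))
        (GGof (A2Z a 0 2) (B2Z a 0) (B2Z a 2) (k.nZ 0) (k.nZ 2) (C2 a)) (GGof (A2Z a 1 2) (B2Z a 1) (B2Z a 2) (k.nZ 1) (k.nZ 2) (C2 a))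
        (ggof (B2Z a 0) (k.nZ 0) (C2 a)) (ggof (B2Z a 1) (k.nZ 1) (C2 a)) (ggof (B2Z a 2) (k.nZ 2) (C2 a)) (C2 a) =
        penV k (GGof (A00 a) (B0 a) (B0 a) k.n0 k.n0 (C2 a)) (GGof (A11 a) (B1 a) (B1 a) k.n1 k.n1 (C2 a)) (GGof (A22 a) (B2 a) (B2 a) k.n2 k.n2 (C2 a))
        (GGof (A01 a) (B0 a) (B1 a) k.n0 k.n1 (C2 a)) (GGof (A02 a) (B0 a) (B2 a) k.n0 k.n2 (C2 a)) (GGof (A12 a) (B1 a) (B2 a) k.n1 k.n2 (C2 a))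
        (ggof (B0 a) k.n0 (C2 a)) (ggof (B1 a) k.n1 (C2 a)) (ggof (B2 a) k.n2 (C2 a)) (C2 a) := rfl
    rw [hsame] at hKT
    have hPEN : PENR k (GamR tab k labs) (gamR tab k labs) (CR tab k labs) ≤ ((GV k a : ℕ) : ℝ) / SC ^ 2 := by
      rw [le_div_iff₀ (by positivity)]
      have hS5 : (0 : ℝ) < SC ^ 5 := by positivity
      have := hpen
      rw [← hKT] at this
      nlinarith [this, hGV, hS]
    have hPENR : PENR k (GamR tab k labs) (gamR tab k labs) (CR tab k labs) =
        2 * ∑ a', ∑ c, ((k.wN a' c : ℕ) : ℝ) / SC * |∑ c', ((k.vZ a' c' : ℤ) : ℝ) / SC * GamR tab k labs c' c|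
        + 2 * ∑ c, ((k.mN c : ℕ) : ℝ) / SC * |∑ a', ((k.vZ a' c : ℤ) : ℝ) / SC * ∑ c', ((k.vZ a' c' : ℤ) : ℝ) / SC * gamR tab k labs c'|
        + 2 * ∑ a', |∑ c, ((k.vZ a' c : ℤ) : ℝ) / SC * gamR tab k labs c| * ∑ c, ((k.wN a' c : ℕ) : ℝ) / SC * (((k.mN c : ℕ) : ℝ) / SC)
        + ∑ a', ∑ c, ∑ c', ((k.wN a' c : ℕ) : ℝ) / SC * (((k.wN a' c' : ℕ) : ℝ) / SC) * |GamR tab k labs c c'|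
        + 2 * ∑ a', (∑ c, ((k.wN a' c : ℕ) : ℝ) / SC * |gamR tab k labs c|) *
            ∑ c, (|((k.vZ a' c : ℤ) : ℝ) / SC| + ((k.wN a' c : ℕ) : ℝ) / SC) * (((k.mN c : ℕ) : ℝ) / SC)
        + |CR tab k labs| * ∑ a', (∑ c, (|((k.vZ a' c : ℤ) : ℝ) / SC| + ((k.wN a' c : ℕ) : ℝ) / SC) * (((k.mN c : ℕ) : ℝ) / SC)) ^ 2 := rfl
    rw [hPENR] at hPEN
    linarith [hFLB, hPEN]
  -- the main theorem
  have hmain := leaf_sound_vector_form S (fun _ q => effPot w₄₅ ω₄ (3 / 400) (Real.sqrt q))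
    (fun _ t => deriv (effPot w₄₅ ω₄ (3 / 400)) (Real.sqrt t) / (2 * Real.sqrt t))
    (fun l => qre l V η) (fun l => qhat k l) (fun l => ((QV k l : ℕ) : ℝ) / SC) (fun l => (((RV k l : ℕ) : ℝ) - 1) / SC)
    (fun l => (((rowTV tab k l).t : ℤ) : ℝ) / SC) (fun l => ((sgnZ (rowTV tab k l).sV (rowTV tab k l).aV : ℤ) : ℝ) / SC)
    (fun l => ((Dz tab k l : ℤ) : ℝ) / SC) (fun l => (((rowTV tab k l).aD : ℕ) : ℝ) / SC) (fun l => (((rowTV tab k l).M : ℤ) : ℝ) / SC)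
    (fun l => (((rowTV tab k l).A : ℤ) : ℝ) / SC) (fun l => (((rowTV tab k l).B : ℤ) : ℝ) / SC)
    ((E : ℝ) / SC) (1 / SC) (((GV k a : ℕ) : ℝ) / SC ^ 2) (((sgnZ sμ aμ : ℤ) : ℝ) / SC / 2)
    (div_nonneg (Nat.cast_nonneg _) hS.le) (div_nonneg zero_le_one hS.le)
    (fun l hl => (RS l hl).2.2.1)
    (fun l hl t ht => hasDerivAt_phi45 (lt_of_lt_of_le (div_pos (by exact_mod_cast (RS l hl).2.2.2.2.1) hS) ht.1))
    (fun l hl => (RS l hl).2.2.2.1)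
    (fun l hl => ⟨div_le_div_of_nonneg_right (by exact_mod_cast (RS l hl).2.2.2.2.2.1) hS.le,
      div_le_div_of_nonneg_right (by exact_mod_cast (RS l hl).2.2.2.2.2.2) hS.le⟩)
    (fun l hl => (LVF l hl).1)
    (fun l hl => ⟨(LVF l hl).2.1, by rw [← add_div]; exact (LVF l hl).2.2⟩)
    ?hlo ?hhi ?hpQ (fun l hl => (RS l hl).1) ?hD ?haD hFun ?hcheck
  · exact hmain
  case hlo =>
    intro l hl
    obtain ⟨h1, h2, -, -⟩ := hF l hl
    rw [← sub_div]
    refine div_le_div_of_nonneg_right ?_ hS.le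
    have : (((rowTV tab k l).A : ℤ) : ℝ) ≤ ((QV k l : ℕ) : ℝ) - ((RV k l : ℕ) : ℝ) := by
      have h2' : ((rowTV tab k l).A : ℤ) ≤ (QV k l : ℤ) - (RV k l : ℤ) := by omega
      exact_mod_cast h2'
    linarith
  case hhi =>
    intro l hl
    obtain ⟨-, -, h3, -⟩ := hF l hl
    rw [← add_div, ← add_div]
    refine div_le_div_of_nonneg_right ?_ hS.le
    have : ((QV k l : ℕ) : ℝ) + ((RV k l : ℕ) : ℝ) ≤ (((rowTV tab k l).B : ℤ) : ℝ) := by exact_mod_cast h3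
    linarith
  case hpQ =>
    intro l hl
    obtain ⟨-, -, -, h4⟩ := hF l hl
    exact div_le_div_of_nonneg_right (by exact_mod_cast h4) hS.le
  case hD =>
    intro l hl
    have hm := (RS l hl).2.1
    rw [abs_sub_le_iff]
    unfold Dz
    constructor
    · have := hm.2; push_cast at this ⊢; rw [add_div] at this; linarith
    · have := hm.1; push_cast at this ⊢; rw [sub_div] at this; linarith
  case haD =>
    intro l hl
    unfold Dz
    rw [abs_div, abs_of_pos hS]
    refine div_le_div_of_nonneg_right (le_of_eq ?_) hS.le
    exact_mod_cast abs_sgnZ (rowTV tab k l).sD (rowTV tab k l).aD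
  case hcheck =>
    have hδ : ∀ l ∈ S, ((QV k l : ℕ) : ℝ) / SC - (((rowTV tab k l).t : ℤ) : ℝ) / SC = ((dltV tab k l : ℕ) : ℝ) / SC := by
      intro l hl; rw [hdlt l hl, sub_div]; push_cast; ring
    -- (i) values
    have hSV : ∑ l ∈ S, ((sgnZ (rowTV tab k l).sV (rowTV tab k l).aV : ℤ) : ℝ) / SC = ((((a.vP : ℕ) : ℤ) - ((a.vN : ℕ) : ℤ) : ℤ) : ℝ) / SC := by
      rw [← Finset.sum_div, hSdef, List.sum_toFinset _ hTnd, cast_list_sum_intG, ← eV]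
    -- (ii) centre corrections
    have hSD : ∑ l ∈ S, ((Dz tab k l : ℤ) : ℝ) / SC * (((QV k l : ℕ) : ℝ) / SC - (((rowTV tab k l).t : ℤ) : ℝ) / SC) =
        ((((a.dP : ℕ) : ℤ) - ((a.dN : ℕ) : ℤ) : ℤ) : ℝ) / SC ^ 2 := by
      have hterm : ∀ l ∈ S, ((Dz tab k l : ℤ) : ℝ) / SC * (((QV k l : ℕ) : ℝ) / SC - (((rowTV tab k l).t : ℤ) : ℝ) / SC) =
          ((sgnZ (rowTV tab k l).sD (rowTV tab k l).aD * (dltV tab k l : ℤ) : ℤ) : ℝ) / SC ^ 2 := by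
        intro l hl; rw [hδ l hl]; unfold Dz; push_cast; field_simp
      rw [Finset.sum_congr rfl hterm, ← Finset.sum_div, hSdef, List.sum_toFinset _ hTnd, cast_list_sum_intG, ← eD]
    have hSs : ∑ l ∈ S, (((QV k l : ℕ) : ℝ) / SC - (((rowTV tab k l).t : ℤ) : ℝ) / SC) = ((a.sd : ℕ) : ℝ) / SC := by
      rw [Finset.sum_congr rfl hδ, ← Finset.sum_div, hSdef, List.sum_toFinset _ hTnd, cast_list_sum_natG, ← eS]
    -- (iii) aD and R sums
    have hSA : ∑ l ∈ S, ((((rowTV tab k l).aD : ℕ) : ℝ) / SC + (E : ℝ) / SC) = ((a.sa : ℕ) : ℝ) / SC + (S.card : ℝ) * ((E : ℝ) / SC) := by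
      rw [Finset.sum_add_distrib, Finset.sum_const, nsmul_eq_mul, ← Finset.sum_div, hSdef, List.sum_toFinset _ hTnd, cast_list_sum_natG, ← eSA,
        List.card_toFinset, List.Nodup.dedup hTnd]
    have hSR : ∑ l ∈ S, (((RV k l : ℕ) : ℝ) - 1) / SC = ((a.sr : ℕ) : ℝ) / SC - (S.card : ℝ) * (1 / SC) := by
      have e1 : ∀ l ∈ S, (((RV k l : ℕ) : ℝ) - 1) / SC = ((RV k l : ℕ) : ℝ) / SC - 1 / SC := fun l _ => by rw [sub_div]
      rw [Finset.sum_congr rfl e1, Finset.sum_sub_distrib, Finset.sum_const, nsmul_eq_mul, ← Finset.sum_div, hSdef,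
        List.sum_toFinset _ hTnd, cast_list_sum_natG, ← eSR, List.card_toFinset, List.Nodup.dedup hTnd]
    -- (iv) curvature
    have hSC : ∑ l ∈ S, (((rowTV tab k l).M : ℤ) : ℝ) / SC *
          (((QV k l : ℕ) : ℝ) / SC - (((rowTV tab k l).t : ℤ) : ℝ) / SC + (((RV k l : ℕ) : ℝ) - 1) / SC + 1 / SC) ^ 2 =
        ((a.cur : ℕ) : ℝ) / SC ^ 3 := by
      have hterm : ∀ l ∈ S, (((rowTV tab k l).M : ℤ) : ℝ) / SC *
            (((QV k l : ℕ) : ℝ) / SC - (((rowTV tab k l).t : ℤ) : ℝ) / SC + (((RV k l : ℕ) : ℝ) - 1) / SC + 1 / SC) ^ 2 =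
          (((rowTV tab k l).M * ((dltV tab k l + RV k l) * (dltV tab k l + RV k l)) : ℕ) : ℝ) / SC ^ 3 := by
        intro l hl; rw [hδ l hl]; push_cast; field_simp; ring
      rw [Finset.sum_congr rfl hterm, ← Finset.sum_div, hSdef, List.sum_toFinset _ hTnd, cast_list_sum_natG, ← eC]
    -- (v) the integer inequality, scaled
    have hX : ((addP sμ aμ 0 : ℕ) : ℝ) - ((addN sμ aμ 0 : ℕ) : ℝ) = ((sgnZ sμ aμ : ℤ) : ℝ) := by exact_mod_cast addP_sub_addN sμ aμ
    have hleR : ((lhsV E (addP sμ aμ 0) (GV k a) a : ℕ) : ℝ) ≤ ((rhsV (addN sμ aμ 0) a : ℕ) : ℝ) := by exact_mod_cast hle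
    unfold lhsV rhsV at hleR
    simp only [Nat.add_eq, Nat.mul_eq, SCN_eq] at hleR
    push_cast at hleR
    have key : ((sgnZ sμ aμ : ℤ) : ℝ) * (SC : ℝ) ^ 2 ≤
        2 * (((((a.vP : ℕ) : ℤ) - ((a.vN : ℕ) : ℤ) : ℤ) : ℝ) * (SC : ℝ) ^ 2 +
          (((((a.dP : ℕ) : ℤ) - ((a.dN : ℕ) : ℤ) : ℤ) : ℝ)) * SC - (E : ℝ) * ((a.sd : ℕ) : ℝ) * SC - ((a.sa : ℕ) : ℝ) * SC
          - (E : ℝ) * ((a.sr : ℕ) : ℝ) * SC - ((GV k a : ℕ) : ℝ) * SC) - ((a.cur : ℕ) : ℝ) := by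
      rw [← hX]; push_cast; nlinarith [hleR]
    have key' : ((sgnZ sμ aμ : ℤ) : ℝ) / SC / 2 ≤ ((((a.vP : ℕ) : ℤ) - ((a.vN : ℕ) : ℤ) : ℤ) : ℝ) / SC +
        (((((a.dP : ℕ) : ℤ) - ((a.dN : ℕ) : ℤ) : ℤ) : ℝ)) / SC ^ 2 - (E : ℝ) / SC * (((a.sd : ℕ) : ℝ) / SC) - ((a.sa : ℕ) : ℝ) / SC ^ 2
        - (E : ℝ) / SC * (((a.sr : ℕ) : ℝ) / SC) - ((GV k a : ℕ) : ℝ) / SC ^ 2 - 1 / 2 * (((a.cur : ℕ) : ℝ) / SC ^ 3) := by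
      have h3 : (0:ℝ) < 2 * (SC : ℝ) ^ 3 := by positivity
      have := div_le_div_of_nonneg_right key h3.le
      calc ((sgnZ sμ aμ : ℤ) : ℝ) / SC / 2 = ((sgnZ sμ aμ : ℤ) : ℝ) * (SC : ℝ) ^ 2 / (2 * (SC : ℝ) ^ 3) := by field_simp
        _ ≤ _ := this
        _ = _ := by field_simp
    rw [hSV, hSD, hSs, hSA, hSR, hSC]
    ring_nf at key' ⊢
    linarith

end Summit.AtomisticToContinuum.Crystallization.Theorems.FrustratedLawDichotomyStrainedPatchHomLeafTableCheckHcpV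

end
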